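import Summits.QuantumFields.BalabanUV.Beta.GAN24.WSlotT2OfPieces

/-!
# `BalabanUV.Beta.GAN24.WSlotT2DriftFromOne` — binder row G-an2-4 / (CONV-C), W-slot road «W3» (SKELETON-W3 v1.0.2 §8.3; typer `LEAVES.md`
# v3.13 § IV-C; GAPS § G-gan24ref1-30-1; ref2 R61-2 (b)∕(c), condition (w12)): **END #2′ — THE DIFFERENCE TOWER UNROLLED FROM `D♮₁`** (the
# re-cut (R1) of record), a W3-L7 one-shot composition with the SAME CONCLUSION TEXT as the owner's END #2 `WSlotT2OfPieces.t2Drift_of_rows`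

NOT IN PRINT; OUR BOOKKEEPING — [folklore] composition over the owner's generic END (`WSlotT2OfPieces.rate_of_rows` ∕ `cauchy_of_rate` ∕
`sup_of_locStencil₂`, gan24-p1-g5, p213240) (G-an2-4 formalisation swarm, leaf prover `b2b-balaban-gan24-formalise-leaf-18`, gen 18; module name
PROVISIONAL — yields to the owner gan24-p1 successor, who may re-file it under the END's own name).  HONEST FRAMING (cell contract, verbatim):
«discharging `BetaPertH` makes Bałaban's UV stability UNCONDITIONAL — a real constructive-QFT result; it is NOT the continuum limit and NOT the Clay
problem.»  HONEST DEPENDENCY (verbatim): «continuum YM on T⁴ ⇐ BetaPertH ∧ nine spine estimates (0/9 proved); BetaPertH ⇐ (D1) ∧ (D4) ∧ CAP+tail;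
G-an2-4 gates asym, D1 and NE2/3/4.»

WHY.  END #2 unrolls the one-step differences `D♮_n = T♮_{n+1} − T♮_n` of an2's normalised Stage-B family from `D♮₀` and asks `hZ0 : Zfree (D♮₀)`;
at an3's colour-traced table that hypothesis is incompatible with ROW W3-F2a for every `cE₂ ≠ 0` (`WilsonQuarticChargeOffDiag.not_hZ0_of_hZb0_w22`,
GAPS § G-gan24ref1-30-1): the linear part acts on the ff charge by `λ₀·Sym_{bond}` (`ChargeStepSym.zmode_succ_eq`), so the bond-antisymmetric part
of the initial quartic charge survives in `D♮₀` whatever the pin.  After ONE MORE transport it is gone (`Sym ∘ Asym = 0`): `Zfree (D♮₁)` holds at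
the exact pin for EVERY table (`ChargeStepSymD1.hZ1_three`) and, at `w22 N`, iff the pin is exact (`ChargeStepSymD1.hZ1_iff_pinEq_w22`).  Hence the
re-cut (R1) (journal l.9613 ∕ l.10060; ref2 R61-2 (b) «the re-cut of record»): unroll from `D♮₁`, absorb member `0` by its shape.
WHAT.
* §1 `rate_of_rows_from_one` (generic tower `D`, forcing `f`, transport `P`, predicate `Zfree`, functional `mom` — all PARAMETERS, as in the
  owner's `rate_of_rows`): from `hsplit : ∀ n, D (n+1) = P 0 n (D 1) + Σ_{i<n} P (i+1) (n−1−i) (f (i+1))`, the irrelevant-transport row `hTirr`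
  (text of END #2), the forcing rows `hf`, `hZf` (texts of END #2, UNSHIFTED — condition (w12): «re-plug unchanged»), the member-1 rows
  `h1 : LocStencil₂ (D 1) C₁ δin ∧ mom (D 1) ≤ C₁`, `hZ1 : Zfree (D 1)`, and the member-0 SHAPE `h00 : LocStencil₂ (D 0) C₀₀ δT`:
  `∃ c ϑ, 0 ≤ c ∧ 0 < ϑ < 1 ∧ ∀ n, LocStencil₂ (D n) (c·ϑ^n) δT` — the owner's `rate_of_rows` on the shifted tower `n ↦ D (n+1)` (forcing
  `m ↦ f (m+1)`, constant `C_f·θ`), member `0` absorbed with `c := C₀₀ + c′·ϑ⁻¹` (ref2 R61-2 (b): «absorbed inside END #2′, not pushed to the wall»).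
* §2 **`t2Drift_of_rows_from_one`** — END #2′ AT THE §8.3 INSTANTIATION: for `D♮_n := T♮_{n+1} − T♮_n`,
  `T♮_j := unitS₂ (sfStep Lc j) (smStep d Lc j) (T2Of d Lc cE cVH cΛ cE₂ cB Tc (vh₂S d Lc) mixFF j)`, the binders of `t2Drift_of_rows` re-indexed per
  (w12) — `hsplit` from level `1` (leaf-01's `T2UnitSplitFrom.unitS₂_T2Of_sub_eq_transport_add_sum_one_vh₂S_of_mix` at `P := fun m k ↦ transport 𝒜 (m+2) k`
  and the literal forcing `f♮`), `hTirr`∕`hf`∕`hZf` VERBATIM, `h1`∕`hZ1` on `D♮₁` (ROW W3-F4d′: shape by leaf-07's route, `Zfree` by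
  `ChargeStepSymD1.hZ1_three` under the exact pin), `h00` on `D♮₀` (leaf-07's `WSlotFirstDiff.hD0_shape`, at the END's output rate) — with
  **CONCLUSION TEXT IDENTICAL TO `t2Drift_of_rows`** (one-step form ∧ Cauchy form ∧ entrywise sup-rate), so r49's wall socket
  `WSlotCauchyThree.hW_hWall_three_of_T2ShapeDrift` is met unchanged.  NO pin hypothesis (as in END #2: every term is zero-mode-free; the pin
  enters only through the rows that discharge `hZ1` and `hTirr`).
HONEST: a composition of HYPOTHESES; rows F2a, F4d′ (`hZ1` needs the EXACT pin), `hTirr` (under `hpin`) are OPEN binders here; asserts NO shape of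
Bałaban's tables; discharges NOTHING of «T2Shape» ∕ «T2Drift» ∕ (hW, hWall); 0 `def`, 0 `def … : Prop`, 0 cite, 0 sorry, 0 wall binders
instantiated; NOT «W-slot closed», NEVER «G-an2-4 closed», NOT (CONV-C); NOT BetaPertH, NOT continuum, NOT Clay.
-/

noncomputable section

open Finset
open scoped BigOperators
open Literature.MathematicalPhysics.QuantumFieldTheory
open Literature.MathematicalPhysics.QuantumFieldTheory.Balaban1983to89
open Literature.MathematicalPhysics.QuantumFieldTheory.Balaban1983to89.Beta
open ExpKernelCalculus (MKer)
open OneStepResolventKernel (Fib)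
open BalabanCompositeJets (LocStencil₂)
open BalabanStepW2 (T2Of)
open AveragingMixedJetTables (vh₂S)
open Summit.QuantumFields.BalabanUV.Beta.SecondOrderUnits (unitS₂)
open Summit.QuantumFields.BalabanUV.Beta.GAN24.CombesThomas (sfStep smStep)
open Summit.QuantumFields.BalabanUV.Beta.GAN24.WSlotT2OfPieces (locStencil₂_mono rate_of_rows cauchy_of_rate sup_of_locStencil₂)

namespace Summit.QuantumFields.BalabanUV.Beta.GAN24.WSlotT2DriftFromOne

variable {d : ℕ}

/-! ## §1 Generic: the tower of differences unrolled from member `1`, member `0` absorbed by its shape -/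

section Rate

/-- [folklore] **END #2′, GENERIC FORM — THE DIFFERENCE TOWER UNROLLED FROM MEMBER `1`.**  If `D (n+1) = P 0 n (D 1) + Σ_{i<n} P (i+1) (n−1−i) (f (i+1))`
with `D 1` and every `f m` zero-mode-free (`hZ1`, `hZf`), the forcing of size `C_f·θ^m` in shape AND first moment (`hf`), the transport irrelevant on
zero-mode-free tables (`hTirr`, gain `ρ^k`), and member `0` merely a `LocStencil₂` table at the output rate (`h00`), then `D n` is a `LocStencil₂`
family with constant `c·ϑ^n`, `c ≥ 0`, `ϑ ∈ (0,1)`.  (The owner's `WSlotT2OfPieces.rate_of_rows` on `n ↦ D (n+1)`, forcing `m ↦ f (m+1)` of constant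
`C_f·θ`; then `c := C₀₀ + c′·ϑ⁻¹`.)  The rows `hTirr`, `hf`, `hZf` are the UNCHANGED texts of END #2 (ref2 R61-2 (c), condition (w12)). -/
theorem rate_of_rows_from_one (D f : ℕ → Fin (d + 1) → (Fin (d + 1) → ℤ) → Fin (d + 1) → (Fin (d + 1) → ℤ) → MKer (d + 1) (Fib d)) (P : ℕ → ℕ → (Fin (d + 1) → (Fin (d + 1) → ℤ) → Fin (d + 1) → (Fin (d + 1) → ℤ) → MKer (d + 1) (Fib d)) → Fin (d + 1) → (Fin (d + 1) → ℤ) → Fin (d + 1) → (Fin (d + 1) → ℤ) → MKer (d + 1) (Fib d)) (Zfree : (Fin (d + 1) → (Fin (d + 1) → ℤ) → Fin (d + 1) → (Fin (d + 1) → ℤ) → MKer (d + 1) (Fib d)) → Prop) (mom : (Fin (d + 1) → (Fin (d + 1) → ℤ) → Fin (d + 1) → (Fin (d + 1) → ℤ) → MKer (d + 1) (Fib d)) → ℝ)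
    {δin δT CT' ρ θ Cf C₁ C₀₀ : ℝ} (hCT' : 0 ≤ CT') (hρ0 : 0 ≤ ρ) (hρ1 : ρ < 1) (hθ0 : 0 ≤ θ) (hθ1 : θ < 1)
    (hsplit : ∀ n, D (n + 1) = P 0 n (D 1) + ∑ i ∈ Finset.range n, P (i + 1) (n - 1 - i) (f (i + 1)))
    (hTirr : ∀ (m k : ℕ) (X : Fin (d + 1) → (Fin (d + 1) → ℤ) → Fin (d + 1) → (Fin (d + 1) → ℤ) → MKer (d + 1) (Fib d)) (C : ℝ), 0 ≤ C → LocStencil₂ X C δin → Zfree X → mom X ≤ C →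
      LocStencil₂ (P m k X) (CT' * C * ρ ^ k) δT)
    (hf : ∀ m, LocStencil₂ (f m) (Cf * θ ^ m) δin ∧ mom (f m) ≤ Cf * θ ^ m) (hZf : ∀ m, Zfree (f m))
    (h1 : LocStencil₂ (D 1) C₁ δin ∧ mom (D 1) ≤ C₁) (hZ1 : Zfree (D 1))
    (h00 : LocStencil₂ (D 0) C₀₀ δT) :
    ∃ c ϑ : ℝ, 0 ≤ c ∧ 0 < ϑ ∧ ϑ < 1 ∧ ∀ n, LocStencil₂ (D n) (c * ϑ ^ n) δT := by
  have hf' : ∀ m, LocStencil₂ (f (m + 1)) (Cf * θ * θ ^ m) δin ∧ mom (f (m + 1)) ≤ Cf * θ * θ ^ m := fun m => by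
    have e : Cf * θ ^ (m + 1) = Cf * θ * θ ^ m := by ring
    exact ⟨locStencil₂_mono (hf (m + 1)).1 e.le, (hf (m + 1)).2.trans e.le⟩
  obtain ⟨c, ϑ, hc, hϑ0, hϑ1, hD⟩ := rate_of_rows (fun n => D (n + 1)) (fun m => f (m + 1)) P Zfree mom hCT' hρ0 hρ1 hθ0 hθ1
    hsplit hTirr hf' (fun m => hZf (m + 1)) h1 hZ1
  have hC₀₀ : 0 ≤ C₀₀ := h00.nonneg
  refine ⟨C₀₀ + c * ϑ⁻¹, ϑ, by positivity, hϑ0, hϑ1, fun n => ?_⟩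
  rcases n with _ | m
  · refine locStencil₂_mono h00 ?_
    rw [pow_zero, mul_one]
    exact le_add_of_nonneg_right (by positivity)
  · refine locStencil₂_mono (hD m) ?_
    have hϑne : ϑ ≠ 0 := hϑ0.ne'
    have e : c * ϑ ^ m = c * ϑ⁻¹ * ϑ ^ (m + 1) := by
      rw [pow_succ', mul_assoc, inv_mul_cancel_left₀ hϑne]
    rw [e]
    exact mul_le_mul_of_nonneg_right (le_add_of_nonneg_left hC₀₀) (pow_nonneg hϑ0.le _)

end Rate

/-! ## §2 END #2′ at the §8.3 instantiation — same conclusion text as `WSlotT2OfPieces.t2Drift_of_rows` -/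

section Literal

variable {Lc : ℕ} [NeZero Lc]

/-- **«T2Drift» ∕ «T2SupRate» AS A FUNCTION OF THE RE-INDEXED ROW FAMILIES OF ROAD «W3» — END #2′, UNROLLED FROM `D♮₁`** (re-cut (R1) of record,
ref2 R61-2): for the one-step DIFFERENCES `D♮_n := T♮_{n+1} − T♮_n` of an2's normalised Stage-B family, given (F1b′) `hsplit` — the unrolling FROM
MEMBER `1` through the transport `P` with forcing `f (i+1)` (leaf-01's `T2UnitSplitFrom.…_one_vh₂S_of_mix` at `P := fun m k ↦ transport 𝒜 (m+2) k`) —,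
(F3) `hTirr`, (F4b)∕(F2b) `hf`∕`hZf` — THE UNCHANGED TEXTS OF END #2 —, (F4d′) `h1`∕`hZ1` on `D♮₁` (shape + moment; `Zfree` — at the exact pin by
`ChargeStepSymD1.hZ1_three`, any `Tc`), and the member-`0` shape `h00 : LocStencil₂ D♮₀ C₀₀ δT` (leaf-07's `WSlotFirstDiff.hD0_shape` at the output
rate): the ONE-STEP form `∀ n, LocStencil₂ D♮_n (c·ϑ^n) δT`, the CAUCHY form `∀ k j, LocStencil₂ (T♮_{k+j} − T♮_k) (c·(1−ϑ)⁻¹·ϑ^k) δT`, and the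
ENTRYWISE sup-rate `|T♮_{n+1} − T♮_n| ≤ c·ϑ^n` — LITERALLY the conclusion of `WSlotT2OfPieces.t2Drift_of_rows`, hence the `hT₂d` socket of r49's
`WSlotCauchyThree.hW_hWall_three_of_T2ShapeDrift` unchanged.  No pin hypothesis on this tower.  [folklore] composition (§1, `cauchy_of_rate`,
`sup_of_locStencil₂`). -/
theorem t2Drift_of_rows_from_one (cE cVH cΛ cE₂ cB : ℝ) (Tc : Fin 4 → Fin 4 → Fin 4 → Fin 4 → ℝ)
    (mixFF : Fin (d + 1) → (Fin (d + 1) → ℤ) → Fin (d + 1) → (Fin (d + 1) → ℤ) → MKer (d + 1) (Fib d))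
    (f : ℕ → Fin (d + 1) → (Fin (d + 1) → ℤ) → Fin (d + 1) → (Fin (d + 1) → ℤ) → MKer (d + 1) (Fib d))
    (P : ℕ → ℕ → (Fin (d + 1) → (Fin (d + 1) → ℤ) → Fin (d + 1) → (Fin (d + 1) → ℤ) → MKer (d + 1) (Fib d)) → Fin (d + 1) → (Fin (d + 1) → ℤ) → Fin (d + 1) → (Fin (d + 1) → ℤ) → MKer (d + 1) (Fib d))
    (Zfree : (Fin (d + 1) → (Fin (d + 1) → ℤ) → Fin (d + 1) → (Fin (d + 1) → ℤ) → MKer (d + 1) (Fib d)) → Prop)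
    (mom : (Fin (d + 1) → (Fin (d + 1) → ℤ) → Fin (d + 1) → (Fin (d + 1) → ℤ) → MKer (d + 1) (Fib d)) → ℝ)
    {δin δT CT' ρ θ Cf C₁ C₀₀ : ℝ} (hδT : 0 < δT) (hCT' : 0 ≤ CT') (hρ0 : 0 ≤ ρ) (hρ1 : ρ < 1) (hθ0 : 0 ≤ θ) (hθ1 : θ < 1)
    (hsplit : ∀ n, (fun κ u κ' u' => unitS₂ (sfStep Lc (n + 2)) (smStep d Lc (n + 2)) (T2Of d Lc cE cVH cΛ cE₂ cB Tc (vh₂S d Lc) mixFF (n + 2)) κ u κ' u' - unitS₂ (sfStep Lc (n + 1)) (smStep d Lc (n + 1)) (T2Of d Lc cE cVH cΛ cE₂ cB Tc (vh₂S d Lc) mixFF (n + 1)) κ u κ' u') =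
      P 0 n (fun κ u κ' u' => unitS₂ (sfStep Lc 2) (smStep d Lc 2) (T2Of d Lc cE cVH cΛ cE₂ cB Tc (vh₂S d Lc) mixFF 2) κ u κ' u' - unitS₂ (sfStep Lc 1) (smStep d Lc 1) (T2Of d Lc cE cVH cΛ cE₂ cB Tc (vh₂S d Lc) mixFF 1) κ u κ' u')
        + ∑ i ∈ Finset.range n, P (i + 1) (n - 1 - i) (f (i + 1)))
    (hTirr : ∀ (m k : ℕ) (X : Fin (d + 1) → (Fin (d + 1) → ℤ) → Fin (d + 1) → (Fin (d + 1) → ℤ) → MKer (d + 1) (Fib d)) (C : ℝ),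
      0 ≤ C → LocStencil₂ X C δin → Zfree X → mom X ≤ C → LocStencil₂ (P m k X) (CT' * C * ρ ^ k) δT)
    (hf : ∀ m, LocStencil₂ (f m) (Cf * θ ^ m) δin ∧ mom (f m) ≤ Cf * θ ^ m) (hZf : ∀ m, Zfree (f m))
    (h1 : LocStencil₂ (fun κ u κ' u' => unitS₂ (sfStep Lc 2) (smStep d Lc 2) (T2Of d Lc cE cVH cΛ cE₂ cB Tc (vh₂S d Lc) mixFF 2) κ u κ' u' - unitS₂ (sfStep Lc 1) (smStep d Lc 1) (T2Of d Lc cE cVH cΛ cE₂ cB Tc (vh₂S d Lc) mixFF 1) κ u κ' u') C₁ δin ∧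
      mom (fun κ u κ' u' => unitS₂ (sfStep Lc 2) (smStep d Lc 2) (T2Of d Lc cE cVH cΛ cE₂ cB Tc (vh₂S d Lc) mixFF 2) κ u κ' u' - unitS₂ (sfStep Lc 1) (smStep d Lc 1) (T2Of d Lc cE cVH cΛ cE₂ cB Tc (vh₂S d Lc) mixFF 1) κ u κ' u') ≤ C₁)
    (hZ1 : Zfree (fun κ u κ' u' => unitS₂ (sfStep Lc 2) (smStep d Lc 2) (T2Of d Lc cE cVH cΛ cE₂ cB Tc (vh₂S d Lc) mixFF 2) κ u κ' u' - unitS₂ (sfStep Lc 1) (smStep d Lc 1) (T2Of d Lc cE cVH cΛ cE₂ cB Tc (vh₂S d Lc) mixFF 1) κ u κ' u'))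
    (h00 : LocStencil₂ (fun κ u κ' u' => unitS₂ (sfStep Lc 1) (smStep d Lc 1) (T2Of d Lc cE cVH cΛ cE₂ cB Tc (vh₂S d Lc) mixFF 1) κ u κ' u' - unitS₂ (sfStep Lc 0) (smStep d Lc 0) (T2Of d Lc cE cVH cΛ cE₂ cB Tc (vh₂S d Lc) mixFF 0) κ u κ' u') C₀₀ δT) :
    ∃ c ϑ : ℝ, 0 ≤ c ∧ 0 < ϑ ∧ ϑ < 1 ∧
      (∀ n, LocStencil₂ (fun κ u κ' u' => unitS₂ (sfStep Lc (n + 1)) (smStep d Lc (n + 1)) (T2Of d Lc cE cVH cΛ cE₂ cB Tc (vh₂S d Lc) mixFF (n + 1)) κ u κ' u' - unitS₂ (sfStep Lc n) (smStep d Lc n) (T2Of d Lc cE cVH cΛ cE₂ cB Tc (vh₂S d Lc) mixFF n) κ u κ' u') (c * ϑ ^ n) δT) ∧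
      (∀ k j, LocStencil₂ (fun κ u κ' u' => unitS₂ (sfStep Lc (k + j)) (smStep d Lc (k + j)) (T2Of d Lc cE cVH cΛ cE₂ cB Tc (vh₂S d Lc) mixFF (k + j)) κ u κ' u' - unitS₂ (sfStep Lc k) (smStep d Lc k) (T2Of d Lc cE cVH cΛ cE₂ cB Tc (vh₂S d Lc) mixFF k) κ u κ' u') (c * (1 - ϑ)⁻¹ * ϑ ^ k) δT) ∧
      (∀ n κ u κ' u' x z a b, |unitS₂ (sfStep Lc (n + 1)) (smStep d Lc (n + 1)) (T2Of d Lc cE cVH cΛ cE₂ cB Tc (vh₂S d Lc) mixFF (n + 1)) κ u κ' u' x z a b - unitS₂ (sfStep Lc n) (smStep d Lc n) (T2Of d Lc cE cVH cΛ cE₂ cB Tc (vh₂S d Lc) mixFF n) κ u κ' u' x z a b| ≤ c * ϑ ^ n) := by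
  obtain ⟨c, ϑ, hc, hϑ0, hϑ1, hD⟩ := rate_of_rows_from_one
    (fun n => (fun κ u κ' u' => unitS₂ (sfStep Lc (n + 1)) (smStep d Lc (n + 1)) (T2Of d Lc cE cVH cΛ cE₂ cB Tc (vh₂S d Lc) mixFF (n + 1)) κ u κ' u' - unitS₂ (sfStep Lc n) (smStep d Lc n) (T2Of d Lc cE cVH cΛ cE₂ cB Tc (vh₂S d Lc) mixFF n) κ u κ' u'))
    f P Zfree mom hCT' hρ0 hρ1 hθ0 hθ1 hsplit hTirr hf hZf h1 hZ1 h00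
  refine ⟨c, ϑ, hc, hϑ0, hϑ1, hD, fun k j => ?_, fun n κ u κ' u' x z a b => ?_⟩
  · exact cauchy_of_rate (fun n => unitS₂ (sfStep Lc n) (smStep d Lc n) (T2Of d Lc cE cVH cΛ cE₂ cB Tc (vh₂S d Lc) mixFF n)) hc hϑ0.le hϑ1 hD k j
  · exact sup_of_locStencil₂ hδT.le (hD n) κ u κ' u' x z a b

end Literal

end Summit.QuantumFields.BalabanUV.Beta.GAN24.WSlotT2DriftFromOne

end
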